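import Summits.BirchSwinnertonDyer.BirchSwinnertonDyer.Theorems.ThetaPartnerAtTwoSignedKatoUpToAtTwoLocalTwoPlusColemanKernel
import Summits.BirchSwinnertonDyer.BirchSwinnertonDyer.Theorems.ThetaPartnerAtTwoSignedControlAtTwoPlusCyclicOfHonda
import HarnessLib

/-!
# Route `ThetaPartnerAtTwo` (TP2), crux K3 `SignedKatoDivisibilityUpToAtTwo` (item stmt-BirchSwinnertonDyer-20308),
# line `colemanrat` v4 — THE LOCAL THEORY AT `p = 2`, file 15: **`Ker Col♭ ⊆ ann(E⁺(K_n·K_v))` for every `n`** — Kobayashi's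
# «`ker Col⁺ = H¹_+`» inclusion (Thm. 6.2 / Prop. 8.18–8.23) at `a_p = 0` in Sprung's convention, as a THEOREM OF A PLUS HONDA
# SYSTEM (L)(TR)(GEN)(GEN₀) — every prime, every base

HONEST FRAMING (cell `bsd-wall`, lead `bsd-wall-tp2-p2x` g3): THEOREMS ONLY — no definition, no named fact, no instance, no `sorry`;
algebra on Sprung's transcription and Kobayashi's signed local points; closes no item; BSD is NOT proved by any of this.

## What

File 14 (`…LocalTwoPlusColemanKernel`) proved: a functional `z ∈ Ker Col♭` (`Sprung2012.colemanKer κ ι W 0 g c .flat`, `a_p = 0`) kills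
the `Γ`-orbit of every EVEN-level point `c_{2k}` (Weierstrass division), and the Nakayama step `Ker Col♭ ⊆ ann(A)` for every subgroup
`A ⊆ ℤ[Γ]·c_{2k} + p·A`. The K4 width seat's `SignedEC.plusCyclic_even_of_honda` (Kobayashi Prop. 8.12 i) on the `ℤ_p`-tower in the
kernel) says exactly that Kobayashi's `E⁺(K_{2j}·K_v) = signedLocalPointsOfEmb κ ι W 1 (2j)` IS such an `A` with generator `c_{2j}` for a
plus Honda system `c` — (L) layers, (TR) `Tr_{m+2/m+1} c_{m+2} = −c_m`, (GEN), (GEN₀) — under «no `p`-torsion in `E(K_∞·K_v)`» and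
«layer indices `= p`»; and `E⁺(K_{2j+1}) ≤ E⁺(K_{2j})` (`SignedEC.signedLocalPointsOfEmb_one_odd_le`). Hence:
* `colemanKer_flat_apply_eq_zero_of_mem_signedLocalPointsOfEmb_one_of_honda` — **for a plus Honda system with `a_p = 0`, every
  `z ∈ Ker Col♭` vanishes on `E⁺(K_n·K_v)` for every `n`** (any `K`, `p`, `κ`, `E`, `ι`).
  With `P := 𝓗/ann(E⁺_∞)` and `ι := Col♭` this is the (Col) clause «`ker ι` killed by `2^m`» (here `m = 0`) of the registered stub
  `stub_localRobustPackageTwo` of K3, REDUCED to HONDA⁺@2 = {files 12–13 (points, (L)(TR)(NONDIV)), K4's (GEN)} and to the one missing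
  MAP `col : 𝐇¹ → 𝓗` (the local Tate pairing with `T₂E`-coefficients).
* `colemanKer_flat_annihilates_signedPlus_two_of_honda` — the `p = 2` reading on the sub-row in the currency of K4's stub: granted
  the hypothesis of `SignedEC.stub_plusHondaSystemTwo_of_padic_nonDiv`'s sibling (the FULL Honda system over `ℚ_[2]`, every `ι`) and a
  local lift `g` of the topological generator, `Ker Col♭ ⊆ ann(E⁺(ℚ_{2,n}·ℚ₂))` for all `n` (no-`2`-torsion from the K3 lead's
  `…LocalTwoLayerTorsion`/bsd-2adic's tower torsion is taken as the displayed hypothesis `hnt`, layer indices from K4-w2's dictionary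
  `SignedEC.PlusLayer.index_subgroupOf_localLayerSubgroupOfEmb_two`).

References: [Kobayashi2003] Thm. 6.2 (p. 11), Prop. 8.12 i), Prop. 8.18–8.23 (pp. 17–20); [Sprung2012] Def. 7.9, p. 1485, Open Problem 7.22;
[Sprung2017] Cor. 4.4.
-/

set_option autoImplicit false
-- the Theorems namespace of this sub repeats the summit name by design (D-0017 nested layout)
set_option linter.dupNamespace false

noncomputable section

open scoped Classical

namespace Summit.BirchSwinnertonDyer.BirchSwinnertonDyer.Theorems

namespace SignedKatoOffTwo.LocalTwo

open Literature.NumberTheory.EllipticCurves Literature.NumberTheory.GaloisRepresentations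
  Literature.NumberTheory.EllipticCurves.ZpExtension Literature.NumberTheory.EllipticCurves.Kobayashi2003
  Literature.NumberTheory.EllipticCurves.Sprung2017 Literature.NumberTheory.EllipticCurves.Sprung2012
  Summit.BirchSwinnertonDyer.BirchSwinnertonDyer.Theorems.SignedEC

universe u

section Honda

variable {K : Type u} [Field K] {p : ℕ} [hp : Fact p.Prime] {κ : ZpExtension K p}
variable {E : Type u} [Field E] [Algebra K E] {ι : AlgebraicClosure K →ₐ[K] AlgebraicClosure E}
variable {W : WeierstrassCurve K}

/-- **`Ker Col♭ ⊆ ann(E⁺(K_n·K_v))` for a plus Honda system with `a_p = 0`** (every prime, every base): given no `p`-torsion in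
`E(K_∞·K_v)`, layer indices `[K_{m+1}·K_v : K_m·K_v] = p`, a local lift `g` of the topological generator, and a plus Honda system
`c` — (L) `c_m ∈ E(K_m·K_v)`, (TR) `Tr_{m+2/m+1} c_{m+2} = −c_m`, (GEN) for `m ≥ 1`, (GEN₀) — every functional `z` on `E(K_∞·K_v)` with
`♭`-Coleman value `0` vanishes on Kobayashi's `E⁺(K_n·K_v)` for every `n`: file 14's orbit-killing + Nakayama step, fed with
`SignedEC.plusCyclic_even_of_honda` (`E⁺_{2j} ⊆ ℤ[Γ]c_{2j} + p·E⁺_{2j}`) and `E⁺_{2j+1} ≤ E⁺_{2j}`. Kobayashi's Thm. 6.2 inclusion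
«`ker Col⁺ ⊇`…» dual form / Prop. 8.18–8.23 at `a_p = 0`; no characters, no Gauss sums.
[cite: Kobayashi2003, Thm. 6.2 (p. 11), Prop. 8.12 i), Prop. 8.18–8.23] [cite: Sprung2012, Def. 7.9, p. 1485] -/
theorem colemanKer_flat_apply_eq_zero_of_mem_signedLocalPointsOfEmb_one_of_honda
    (hnt : ∀ P ∈ localTowerPointsOfEmb κ ι W, p • P = 0 → P = 0)
    (hidx : ∀ m : ℕ, ((localLayerSubgroupOfEmb κ ι (m + 1)).subgroupOf (localLayerSubgroupOfEmb κ ι m)).index = p)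
    {g : Field.absoluteGaloisGroup E} (hg : κ.IsTopGenerator (resGalOfEmb ι g))
    {c : ℕ → localPoints W E} (hc : ∀ m, c m ∈ localLayerPointsOfEmb κ ι W m)
    (htr : ∀ m, localTraceOfEmb κ ι W (m + 1) (m + 2) (c (m + 2)) = -c m)
    (hgen : ∀ m : ℕ, 1 ≤ m → ∀ P ∈ localLayerPointsOfEmb κ ι W m,
      ∃ B ∈ AddSubgroup.closure (Set.range fun σ : Field.absoluteGaloisGroup E ↦ σ • c m),
        ∃ P' ∈ localLayerPointsOfEmb κ ι W (m - 1), ∃ R ∈ localLayerPointsOfEmb κ ι W m, P = B + P' + p • R)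
    (hgen0 : ∀ P ∈ localLayerPointsOfEmb κ ι W 0, ∃ a : ℤ, ∃ R ∈ localLayerPointsOfEmb κ ι W 0, P = a • c 0 + p • R)
    {z : localTowerPointsOfEmb κ ι W →+ ℤ_[p]} (hz : z ∈ colemanKer κ ι W 0 g c .flat) (n : ℕ) :
    ∀ (x : localPoints W E) (hx : x ∈ signedLocalPointsOfEmb κ ι W 1 n),
      z ⟨x, localLayerPointsOfEmb_le_localTowerPointsOfEmb κ ι W n (signedLocalPointsOfEmb_le κ ι W 1 n hx)⟩ = 0 := by
  -- the even layer `2j` below (or at) `n`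
  have heven : ∀ (j : ℕ) (x : localPoints W E) (hx : x ∈ signedLocalPointsOfEmb κ ι W 1 (2 * j)),
      z ⟨x, localLayerPointsOfEmb_le_localTowerPointsOfEmb κ ι W (2 * j) (signedLocalPointsOfEmb_le κ ι W 1 (2 * j) hx)⟩ = 0 := by
    intro j
    have hA : signedLocalPointsOfEmb κ ι W 1 (2 * j) ≤ localTowerPointsOfEmb κ ι W :=
      fun y hy ↦ localLayerPointsOfEmb_le_localTowerPointsOfEmb κ ι W (2 * j) (signedLocalPointsOfEmb_le κ ι W 1 (2 * j) hy)
    exact colemanKer_flat_apply_eq_zero_of_generated_mod_prime hg hc hz hA j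
      (plusCyclic_even_of_honda W κ ι hnt hidx c hc htr hgen hgen0 j)
  rcases Nat.even_or_odd n with ⟨j, hj⟩ | ⟨j, hj⟩
  · have hn : n = 2 * j := by omega
    subst hn
    exact heven j
  · subst hj
    intro x hx
    have hx' : x ∈ signedLocalPointsOfEmb κ ι W 1 (2 * j) := signedLocalPointsOfEmb_one_odd_le W κ ι hnt j hx
    exact heven j x hx'

end Honda

/-! ## The `p = 2` reading in the currency of K4's stub `stub_plusHondaSystemTwo` (model `ℚ_[2]`, every `ι`) -/

section Two

open Literature.NumberTheory.EllipticCurves.Rank1Residual Summit.BirchSwinnertonDyer.BirchSwinnertonDyer.Theorems.SignedEC.PlusLayer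

/-- **`Ker Col♭ ⊆ ann(E⁺(ℚ_{2,n}·ℚ₂))` at `p = 2`, granted HONDA⁺@2 over `ℚ_[2]`** (the hypothesis of
`SignedEC.stub_plusHondaSystemTwo_of_padic_nonDiv`'s full-Honda sibling: for every `ι`, a system `d` over `ℚ_[2]` with
(L)(TR)(GEN)(GEN₀)), no `2`-torsion in `E(ℚ_{2,∞}·ℚ₂)` (displayed) and a local lift `g` of the topological generator: every
`z ∈ Ker Col♭` for `d` vanishes on `signedLocalPointsOfEmb κ ι W 1 n` for all `n` (layer indices `= 2` by the dictionary
`SignedEC.PlusLayer.index_subgroupOf_localLayerSubgroupOfEmb_two`). Files 12–13 supply `d` with (L)(TR)(NONDIV); (GEN) is K4's.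
[cite: Kobayashi2003, Thm. 6.2, Prop. 8.12 i), Prop. 8.18–8.23] [cite: Sprung2012, Thm. 2.2 (2′), Def. 7.9] -/
theorem colemanKer_flat_annihilates_signedPlus_two_of_honda (W : WeierstrassCurve ℚ) {κ : ZpExtension ℚ 2} (hκ : κ.IsCyclotomic)
    (ι : AlgebraicClosure ℚ →ₐ[ℚ] AlgebraicClosure ℚ_[2])
    (hnt : ∀ P ∈ localTowerPointsOfEmb κ ι W, 2 • P = 0 → P = 0)
    {g : Field.absoluteGaloisGroup ℚ_[2]} (hg : κ.IsTopGenerator (resGalOfEmb ι g))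
    {d : ℕ → localPoints W ℚ_[2]} (hd : ∀ m, d m ∈ localLayerPointsOfEmb κ ι W m)
    (htr : ∀ m, localTraceOfEmb κ ι W (m + 1) (m + 2) (d (m + 2)) = -d m)
    (hgen : ∀ m : ℕ, 1 ≤ m → ∀ P ∈ localLayerPointsOfEmb κ ι W m,
      ∃ B ∈ AddSubgroup.closure (Set.range fun σ : Field.absoluteGaloisGroup ℚ_[2] ↦ σ • d m),
        ∃ P' ∈ localLayerPointsOfEmb κ ι W (m - 1), ∃ R ∈ localLayerPointsOfEmb κ ι W m, P = B + P' + 2 • R)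
    (hgen0 : ∀ P ∈ localLayerPointsOfEmb κ ι W 0, ∃ a : ℤ, ∃ R ∈ localLayerPointsOfEmb κ ι W 0, P = a • d 0 + 2 • R)
    {z : localTowerPointsOfEmb κ ι W →+ ℤ_[2]} (hz : z ∈ colemanKer κ ι W 0 g d .flat) (n : ℕ) :
    ∀ (x : localPoints W ℚ_[2]) (hx : x ∈ signedLocalPointsOfEmb κ ι W 1 n),
      z ⟨x, localLayerPointsOfEmb_le_localTowerPointsOfEmb κ ι W n (signedLocalPointsOfEmb_le κ ι W 1 n hx)⟩ = 0 := by
  have hidx : ∀ m : ℕ, ((localLayerSubgroupOfEmb κ ι (m + 1)).subgroupOf (localLayerSubgroupOfEmb κ ι m)).index = 2 := by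
    intro m
    rw [index_subgroupOf_localLayerSubgroupOfEmb_two ι hκ (Nat.le_succ m), Nat.succ_sub (le_refl m), Nat.sub_self, pow_one]
  exact colemanKer_flat_apply_eq_zero_of_mem_signedLocalPointsOfEmb_one_of_honda
    (fun P hP h2 ↦ hnt P hP (by exact_mod_cast h2)) hidx hg hd htr hgen hgen0 hz n

end Two

end SignedKatoOffTwo.LocalTwo

end Summit.BirchSwinnertonDyer.BirchSwinnertonDyer.Theorems

end
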